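import Literature.NumberTheory.Automorphic.PrincipalSeriesGL2JacquetModule
import Literature.NumberTheory.Automorphic.JacquetFiniteLengthCriterion
import Literature.NumberTheory.Automorphic.ParabolicIndGLNoSupercuspidalSubquotient
import Literature.NumberTheory.Automorphic.ParabolicInductionModulusProofs
import Literature.NumberTheory.Automorphic.JacquetGLFunctor
import Literature.NumberTheory.Automorphic.PAdicRepsJacquetAdmissibilityProofs
import HarnessLib

/-!
# A representation of `GL₂(F)` whose standard `L`-factor has degree `2` is spherical

Topic `Literature/NumberTheory/Automorphic`; proof file (theorems only).  Let `F` be a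
non-archimedean local field and `π` an irreducible smooth representation of `GL₂(F)` on `V`.
**Theorem** (`exists_mem_fixedPoints_glInt_of_hasRSLFactor_natDegree_two`, Jacquet–Langlands
1970, Prop. 3.5 (`L(s, π) = L(s, μ₁) L(s, μ₂)` for `π = π(μ₁, μ₂)`), Prop. 3.6 (special
representations: degree `≤ 1`), Thm. 2.18 / Prop. 2.23 context (supercuspidal: `L = 1`), read
backwards; Gelbart 1975, Thm. 6.15; Godement 1970, §1.3, §1.9–1.11; Bump 1997, §4.7 and
Thm. 4.6.4): if for some non-trivial continuous `ψ` the JPSS `L`-factor `L(s, π × 1) = 1/P(q^{-s})`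
(`HasRSLFactor`, with respect to the invariant measures on `GL₁(F) ⧸ U₁`) has `deg P = 2`, then `π`
has a non-zero `GL₂(𝒪_F)`-fixed vector.

## Proof (classification-free; Steps A–E of `WhittakerTorusJacquetGL2`)

* **C** (`natDegree_le_finrank_of_hasRSLFactor`, file `WhittakerTorusJacquetGL2`): for `V_N`
  finite-dimensional, `deg P ≤ dim M`, `M ≤ V_N` the image of the `d(𝒪ˣ,1)`-fixed vectors.  In
  particular `V_N ≠ 0`.
* **A** (`Representation.exists_isCoatom_subrepresentation_jacquetGL`,
  `Representation.exists_injective_intertwiningMap_parabolicIndGL`): an irreducible quotient `χ`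
  of the `T`-module `V_N` is a character (Schur's lemma in countable dimension, `T` abelian and
  `σ`-compact), and Frobenius reciprocity embeds `π ↪ I(χ ⊗ δ^{-1/2}) = Ind_B(χ)`.
* **B** (`finiteDimensional_coinvariants_parabolicIndGL_fin_two`, file
  `PrincipalSeriesGL2JacquetModule`): `dim I(χ)_N ≤ 2`; `r_N` preserves injections
  (`jacquetGLMap_injective`), so `dim V_N ≤ 2` and C applies:
  `2 = deg P ≤ dim M ≤ dim V_N ≤ dim I_N ≤ 2`, whence `M = V_N ≅ I_N`.
* **D** (`apply_leviProjection_diagGL2_eq_of_jacquetGL_eq`,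
  `apply_leviProjection_diagGL2_swap_eq_of_jacquetGL_eq`): `d(𝒪ˣ, 1)` acts trivially on
  `V_N ≅ I_N`, so both exponents of `I_N` are unramified: `χ` is trivial on `T(𝒪)`, and `I(χ)`
  has the spherical vector `f₀` (`exists_mem_fixedPoints_glInt_parabolicIndGL_fin_two`).
* **E** (`exists_jacquetImage_lt`, `intertwiningMap_subrepresentation_parabolicIndGL_eq_zero`):
  `π ↪ I` is onto — otherwise a proper Jacquet functor separates `π` from `I`, but the only proper
  standard parabolic of `GL₂` is `B` and `r_N π = r_N I` — so `f₀ ∈ π`.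

## References

* H. Jacquet, R. P. Langlands, *Automorphic forms on GL(2)*, LNM 114 (1970), Props. 3.5–3.6,
  Thm. 2.18. [JacquetLanglands1970]
* S. Gelbart, *Automorphic forms on adele groups* (1975), Thm. 6.15, Thm. 4.23. [Gelbart1975]
* I. N. Bernstein, A. V. Zelevinsky, Ann. Sci. ÉNS 10 (1977), Thm. 5.2, §2. [BernsteinZelevinskyASENS1977]
* D. Bump, *Automorphic forms and representations* (1997), §4.5–4.7. [Bump1997]
-/

noncomputable section

open scoped MatrixGroups
open MeasureTheory ValuativeRel Polynomial

namespace Literature.NumberTheory.Automorphic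

variable {F : Type*} [Field F] [ValuativeRel F] [TopologicalSpace F] [IsNonarchimedeanLocalField F]

/-! ### Preliminaries: the torus of `GL₂`, the subgroup `d(𝒪ˣ, 1)`, characters of `T` -/

omit [ValuativeRel F] [TopologicalSpace F] [IsNonarchimedeanLocalField F] in
/-- The standard Levi `Π_a GL₁(F)` of the Borel of `GL₂` is commutative. [folklore] -/
theorem levi_fin_two_mul_comm (g t : Π a, GL {i // (id : Fin 2 → Fin 2) i = a} F) : g * t = t * g := by
  funext a
  haveI : Subsingleton {i // (id : Fin 2 → Fin 2) i = a} := ⟨fun x y => Subtype.ext (x.2.trans y.2.symm)⟩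
  rw [Pi.mul_apply, Pi.mul_apply]
  refine Units.ext (Matrix.ext fun i j => ?_)
  rw [Units.val_mul, Units.val_mul, Matrix.mul_apply, Matrix.mul_apply, Fintype.sum_subsingleton _ i,
    Fintype.sum_subsingleton _ i, Subsingleton.elim j i, mul_comm]

omit [TopologicalSpace F] [IsNonarchimedeanLocalField F] in
/-- **The subgroup `d(𝒪ˣ, 1) ≤ GL₂(F)`.** [folklore] -/
theorem exists_subgroup_diagGL2_units :
    ∃ H : Subgroup (GL (Fin 2) F), ∀ g : GL (Fin 2) F,
      g ∈ H ↔ ∃ u : Fˣ, valuation F (u : F) = 1 ∧ g = diagGL2 u 1 := by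
  refine ⟨{ carrier := {g | ∃ u : Fˣ, valuation F (u : F) = 1 ∧ g = diagGL2 u 1}
            mul_mem' := ?_, one_mem' := ?_, inv_mem' := ?_ }, fun g => Iff.rfl⟩
  · rintro _ _ ⟨u, hu, rfl⟩ ⟨u', hu', rfl⟩
    refine ⟨u * u', by rw [Units.val_mul, map_mul, hu, hu', mul_one], ?_⟩
    rw [← diagGL2_mul, mul_one]
  · exact ⟨1, by rw [Units.val_one, map_one], diagGL2_one.symm⟩
  · rintro _ ⟨u, hu, rfl⟩
    refine ⟨u⁻¹, by rw [Units.val_inv_eq_inv_val, map_inv₀, hu, inv_one], ?_⟩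
    rw [diagGL2_inv_eq, inv_one]

/-- **Irreducible smooth representations of the torus act by scalars** (Schur's lemma in countable
dimension for the abelian `σ`-compact group `T = Π_a GL₁(F)`). [cite: BernsteinZelevinskyRMS1976, §2.11] -/
theorem exists_apply_eq_smul_of_isIrreducible_levi_fin_two {W : Type*} [AddCommGroup W] [Module ℂ W]
    (σ₀ : Representation ℂ (Π a, GL {i // (id : Fin 2 → Fin 2) i = a} F) W) [σ₀.IsIrreducible]
    (hσ₀ : σ₀.IsSmooth) (t : Π a, GL {i // (id : Fin 2 → Fin 2) i = a} F) :
    ∃ c : ℂ, ∀ w : W, σ₀ t w = c • w := by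
  haveI : SigmaCompactSpace (Π a, GL {i // (id : Fin 2 → Fin 2) i = a} F) :=
    sigmaCompactSpace_levi F (id : Fin 2 → Fin 2)
  have hz : t ∈ Subgroup.center (Π a, GL {i // (id : Fin 2 → Fin 2) i = a} F) :=
    Subgroup.mem_center_iff.2 fun g => levi_fin_two_mul_comm g t
  obtain ⟨c, hc⟩ := hσ₀.exists_apply_eq_smul_id_of_mem_center
    (fun U hU => Representation.countable_quotient_of_isOpen_of_sigmaCompactSpace U hU) hz
  exact ⟨c, fun w => by rw [hc, LinearMap.smul_apply, LinearMap.id_apply]⟩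

omit [ValuativeRel F] [TopologicalSpace F] [IsNonarchimedeanLocalField F] in
/-- An irreducible representation on which the group acts by scalars is one-dimensional.
[folklore] -/
theorem finrank_eq_one_of_isIrreducible_of_smul {G : Type*} [Group G] {W : Type*} [AddCommGroup W]
    [Module ℂ W] (σ₀ : Representation ℂ G W) [σ₀.IsIrreducible]
    (hsc : ∀ t : G, ∃ c : ℂ, ∀ w : W, σ₀ t w = c • w) :
    FiniteDimensional ℂ W ∧ Module.finrank ℂ W = 1 := by
  haveI : Nontrivial W := Representation.IsIrreducible.nontrivial σ₀
  obtain ⟨w, hw⟩ := exists_ne (0 : W)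
  let S : Subrepresentation σ₀ :=
    ⟨Submodule.span ℂ {w}, fun t x hx => by
      obtain ⟨c, hc⟩ := hsc t
      rw [hc]
      exact Submodule.smul_mem _ c hx⟩
  have hS : S ≠ ⊥ := by
    intro h
    have hw' : w ∈ S.toSubmodule := Submodule.subset_span rfl
    rw [h] at hw'
    exact hw ((Submodule.mem_bot ℂ).1 hw')
  have htop : S = ⊤ := (IsSimpleOrder.eq_bot_or_eq_top S).resolve_left hS
  have hspan : Submodule.span ℂ {w} = ⊤ := congrArg Subrepresentation.toSubmodule htop
  haveI : FiniteDimensional ℂ W := by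
    rw [FiniteDimensional, Module.finite_def, ← hspan]
    exact Submodule.fg_span (Set.finite_singleton w)
  refine ⟨inferInstance, ?_⟩
  rw [← finrank_top, ← hspan, finrank_span_singleton hw]

/-- The only proper monotone block labelling of `Fin 2` is the identity (the Borel is the only
proper standard parabolic of `GL₂`). [folklore] -/
theorem isProperBlocks_fin_two_elim {P : ∀ r : ℕ, (Fin 2 → Fin r) → Prop}
    (hP : P 2 (id : Fin 2 → Fin 2)) {r : ℕ} (c : Fin 2 → Fin r) (hcp : IsProperBlocks c)
    (hcm : Monotone c) : P r c := by
  obtain ⟨hsurj, hnt⟩ := hcp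
  have hr2 : r ≤ 2 := by simpa using Fintype.card_le_of_surjective c hsurj
  have h2r : 2 ≤ r := by
    have := @Fintype.one_lt_card (Fin r) _ hnt
    simp only [Fintype.card_fin] at this
    omega
  obtain rfl : r = 2 := le_antisymm hr2 h2r
  have hinj : Function.Injective c := Finite.injective_iff_surjective.2 hsurj
  have hc : c = id := by
    have h01 : c 0 < c 1 := lt_of_le_of_ne (hcm (by decide)) (fun h => absurd (hinj h) (by decide))
    have h0 : (c 0 : ℕ) < (c 1 : ℕ) := Fin.lt_def.1 h01
    have h1 : (c 1 : ℕ) < 2 := (c 1).isLt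
    have hc0 : c 0 = 0 := Fin.ext (by rw [Fin.val_zero]; omega)
    have hc1 : c 1 = 1 := Fin.ext (by rw [Fin.val_one]; omega)
    funext i
    fin_cases i
    · exact hc0
    · exact hc1
  subst hc
  exact hP

/-! ### The theorem -/

set_option maxHeartbeats 3200000 in
/-- **An irreducible smooth representation of `GL₂(F)` whose `L`-factor `L(s, π × 1)` has degree
`2` is spherical** (Jacquet–Langlands 1970, Props. 3.5–3.6 with Thm. 2.18, read backwards;
Gelbart 1975, Thm. 6.15; Godement 1970, §1).  Hypotheses: `π` irreducible smooth on `V`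
(`SmoothIrrep`), `ψ` continuous non-trivial, and for every invariant Radon measure `ν` of full
support on `GL₁(F) ⧸ U₁` a polynomial `P` of degree `2` with `HasRSLFactor (1<2) π 1 ψ ν P`.
Conclusion: `π` has a non-zero vector fixed by `GL₂(𝒪_F)` (`glInt 2 F`).  Proof: module
docstring (Steps A–E).  [cite: JacquetLanglands1970, Prop. 3.5, Prop. 3.6, Thm. 2.18]
[cite: Gelbart1975, Thm. 6.15] -/
theorem exists_mem_fixedPoints_glInt_of_hasRSLFactor_natDegree_two
    (πv : SmoothIrrep (GL (Fin 2) F)) (ψ : AddChar F Circle) (hψ : ψ.IsContinuousNontrivial)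
    (hL : ∀ [MeasurableSpace (GL (Fin 1) F ⧸ upperUnitriangular (Fin 1) F)]
      [BorelSpace (GL (Fin 1) F ⧸ upperUnitriangular (Fin 1) F)]
      (ν : Measure (GL (Fin 1) F ⧸ upperUnitriangular (Fin 1) F))
      [SMulInvariantMeasure (GL (Fin 1) F) (GL (Fin 1) F ⧸ upperUnitriangular (Fin 1) F) ν]
      [IsFiniteMeasureOnCompacts ν] [ν.IsOpenPosMeasure],
      ∃ P : ℂ[X], HasRSLFactor Nat.one_lt_two πv.ρ (Representation.trivial ℂ (GL (Fin 1) F) ℂ) ψ ν P ∧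
        P.natDegree = 2) :
    ∃ x : πv.V, x ≠ 0 ∧ x ∈ πv.ρ.fixedPoints (glInt 2 F) := by
  classical
  haveI := πv.isIrreducible
  have hπ : πv.ρ.IsSmooth := πv.isSmooth
  letI : MeasurableSpace F := borel F
  haveI : BorelSpace F := ⟨rfl⟩
  letI : MeasurableSpace (GL (Fin 1) F ⧸ upperUnitriangular (Fin 1) F) := borel _
  haveI : BorelSpace (GL (Fin 1) F ⧸ upperUnitriangular (Fin 1) F) := ⟨rfl⟩
  obtain ⟨H, hH⟩ := exists_subgroup_diagGL2_units (F := F)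
  -- Step C needs `V_N` finite-dimensional; first dispose of `V_N = 0`
  rcases subsingleton_or_nontrivial
    (Representation.restrictUnipotentGL F (id : Fin 2 → Fin 2) πv.ρ).Coinvariants with hVN | hVN
  · exfalso
    obtain ⟨ν, hinv, hfin, hpos, hC⟩ := natDegree_le_finrank_of_hasRSLFactor πv.ρ hπ hψ H hH
    haveI := hinv; haveI := hfin; haveI := hpos
    obtain ⟨P, hP, hdeg⟩ := hL ν
    have h := hC P hP
    rw [hdeg, Module.finrank_zero_of_subsingleton] at h
    exact absurd h (by decide)
  -- Step A: an irreducible quotient `σ₀` of the `T`-module `V_N` (a character) and `π ↪ I(σ)`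
  haveI := hVN
  obtain ⟨N₀, hN₀⟩ := Representation.exists_isCoatom_subrepresentation_jacquetGL F (id : Fin 2 → Fin 2) πv.ρ hπ
  haveI hσ₀irr : N₀.quotientRep.IsIrreducible := Subrepresentation.isIrreducible_quotientRep hN₀
  have hσ₀s : N₀.quotientRep.IsSmooth :=
    (Representation.IsSmooth.jacquetGL F (id : Fin 2 → Fin 2) hπ).quotientRep N₀
  have hq0 : N₀.mkQ ≠ 0 := by
    intro h
    apply hN₀.1
    refine eq_top_iff.2 fun x _ => (N₀.mkQ_eq_zero_iff x).1 ?_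
    rw [h]
    rfl
  -- the inducing datum `σ = σ₀ ⊗ (δ^{1/2} ∘ emb)⁻¹`: smooth, scalar, one-dimensional
  obtain ⟨σ, hσ_def⟩ : ∃ σ : Representation ℂ (Π a, GL {i // (id : Fin 2 → Fin 2) i = a} F)
      ((Representation.restrictUnipotentGL F (id : Fin 2 → Fin 2) πv.ρ).Coinvariants ⧸ N₀.toSubmodule),
      σ = N₀.quotientRep.twist ((rootDeltaChar (standardParabolicGL F (id : Fin 2 → Fin 2))).comp
        (leviEmbeddingP F (id : Fin 2 → Fin 2)))⁻¹ := ⟨_, rfl⟩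
  have hσs : σ.IsSmooth := by
    rw [hσ_def]
    exact Representation.IsSmooth.twist_rootDeltaChar_inv F (id : Fin 2 → Fin 2) hσ₀s
  have hsc₀ := exists_apply_eq_smul_of_isIrreducible_levi_fin_two N₀.quotientRep hσ₀s
  have hscalar : ∀ t, ∃ c : ℂ, ∀ w, σ t w = c • w := fun t => by
    obtain ⟨c, hc⟩ := hsc₀ t
    refine ⟨((((rootDeltaChar (standardParabolicGL F (id : Fin 2 → Fin 2))).comp
      (leviEmbeddingP F (id : Fin 2 → Fin 2)))⁻¹ t : ℂˣ) : ℂ) * c, fun w => ?_⟩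
    rw [hσ_def, Representation.twist_apply, hc, smul_smul]
  obtain ⟨hWfd, hW1⟩ := finrank_eq_one_of_isIrreducible_of_smul N₀.quotientRep hsc₀
  haveI := hWfd
  haveI hWnt := Representation.IsIrreducible.nontrivial N₀.quotientRep
  -- Step B: `dim I(σ)_N ≤ 2`, the embedding `π ↪ I(σ)`, `dim V_N ≤ 2`
  obtain ⟨hJfd, hJle⟩ := finiteDimensional_coinvariants_parabolicIndGL_fin_two σ hσs
  have hJle2 : Module.finrank ℂ (Representation.restrictUnipotentGL F (id : Fin 2 → Fin 2)
      (Representation.parabolicIndGL F (id : Fin 2 → Fin 2) σ)).Coinvariants ≤ 2 :=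
    hJle.trans (by rw [hW1])
  clear hJle
  haveI := hJfd
  have hIs : (Representation.parabolicIndGL F (id : Fin 2 → Fin 2) σ).IsSmooth :=
    Representation.isSmooth_smoothInd _ _
  obtain ⟨f, hf⟩ : ∃ f : πv.ρ.IntertwiningMap (Representation.parabolicIndGL F (id : Fin 2 → Fin 2) σ),
      Function.Injective f := by
    rw [hσ_def]
    exact Representation.exists_injective_intertwiningMap_parabolicIndGL F (id : Fin 2 → Fin 2)
      πv.ρ hπ N₀.quotientRep N₀.mkQ hq0
  have hinj : Function.Injective (jacquetGLMap F (id : Fin 2 → Fin 2) f).toLinearMap :=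
    jacquetGLMap_injective monotone_id hIs f hf
  haveI hVfd : FiniteDimensional ℂ (Representation.restrictUnipotentGL F (id : Fin 2 → Fin 2) πv.ρ).Coinvariants :=
    Module.Finite.of_injective (jacquetGLMap F (id : Fin 2 → Fin 2) f).toLinearMap hinj
  have hVle := LinearMap.finrank_le_finrank_of_injective hinj
  -- Step C: `2 = deg P ≤ dim M ≤ dim V_N`
  obtain ⟨ν, hinv, hfin, hpos, hC⟩ := natDegree_le_finrank_of_hasRSLFactor πv.ρ hπ hψ H hH
  haveI := hinv; haveI := hfin; haveI := hpos
  obtain ⟨P, hP, hdeg⟩ := hL ν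
  have hM := hC P hP
  rw [hdeg] at hM
  have hMle := Submodule.finrank_le (Submodule.map (Representation.Coinvariants.mk
    (Representation.restrictUnipotentGL F (id : Fin 2 → Fin 2) πv.ρ)) (πv.ρ.fixedPoints H))
  have hVN2 : Module.finrank ℂ (Representation.restrictUnipotentGL F (id : Fin 2 → Fin 2) πv.ρ).Coinvariants = 2 :=
    le_antisymm (hVle.trans hJle2) (hM.trans hMle)
  have hJN2 : Module.finrank ℂ (Representation.restrictUnipotentGL F (id : Fin 2 → Fin 2)
      (Representation.parabolicIndGL F (id : Fin 2 → Fin 2) σ)).Coinvariants = 2 :=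
    le_antisymm hJle2 ((hM.trans hMle).trans hVle)
  have hMtop : Submodule.map (Representation.Coinvariants.mk
      (Representation.restrictUnipotentGL F (id : Fin 2 → Fin 2) πv.ρ)) (πv.ρ.fixedPoints H) = ⊤ :=
    Submodule.eq_top_of_finrank_eq (le_antisymm hMle ((hVle.trans hJle2).trans hM))
  have hsurjJ : Function.Surjective (jacquetGLMap F (id : Fin 2 → Fin 2) f).toLinearMap :=
    (LinearMap.injective_iff_surjective_of_finrank_eq_finrank
      (f := (jacquetGLMap F (id : Fin 2 → Fin 2) f).toLinearMap) (hVN2.trans hJN2.symm)).1 hinj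
  -- Step D: `d(𝒪ˣ, 1)` acts trivially on `V_N = M`, hence on `I_N`, so `σ` is unramified
  have htrivV : ∀ u : Fˣ, valuation F (u : F) = 1 →
      ∀ x : (Representation.restrictUnipotentGL F (id : Fin 2 → Fin 2) πv.ρ).Coinvariants,
      Representation.jacquetGL F (id : Fin 2 → Fin 2) πv.ρ (leviProjection F (id : Fin 2 → Fin 2)
        ⟨diagGL2 u 1, diagGL2_mem_standardParabolicGL_fin_two u 1⟩) x = x := by
    intro u hu x
    have hx : x ∈ Submodule.map (Representation.Coinvariants.mk
        (Representation.restrictUnipotentGL F (id : Fin 2 → Fin 2) πv.ρ)) (πv.ρ.fixedPoints H) := by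
      rw [hMtop]; trivial
    obtain ⟨v, hv, rfl⟩ := Submodule.mem_map.1 hx
    rw [jacquetGL_leviProjection_diagGL2_mk,
      (πv.ρ.mem_fixedPoints H v).1 hv _ ((hH _).2 ⟨u, hu, rfl⟩)]
  have htrivJ : ∀ u : Fˣ, valuation F (u : F) = 1 →
      ∀ y : (Representation.restrictUnipotentGL F (id : Fin 2 → Fin 2) (Representation.parabolicIndGL F (id : Fin 2 → Fin 2) σ)).Coinvariants,
      Representation.jacquetGL F (id : Fin 2 → Fin 2) (Representation.parabolicIndGL F (id : Fin 2 → Fin 2) σ) (leviProjection F (id : Fin 2 → Fin 2)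
        ⟨diagGL2 u 1, diagGL2_mem_standardParabolicGL_fin_two u 1⟩) y = y := by
    intro u hu
    refine hsurjJ.forall.2 fun x => ?_
    have h1 := congrArg (jacquetGLMap F (id : Fin 2 → Fin 2) f) (htrivV u hu x)
    have h2 := (jacquetGLMap F (id : Fin 2 → Fin 2) f).isIntertwining _ _
      (leviProjection F (id : Fin 2 → Fin 2) ⟨diagGL2 u 1, diagGL2_mem_standardParabolicGL_fin_two u 1⟩) x
    exact h2.symm.trans h1
  have h₁ : ∀ u : Fˣ, valuation F (u : F) = 1 → ∀ w, σ (leviProjection F (id : Fin 2 → Fin 2)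
      ⟨diagGL2 u 1, diagGL2_mem_standardParabolicGL_fin_two u 1⟩) w = w :=
    fun u hu w => apply_leviProjection_diagGL2_eq_of_jacquetGL_eq σ hσs hu (htrivJ u hu) w
  have h₂ : ∀ u : Fˣ, valuation F (u : F) = 1 → ∀ w, σ (leviProjection F (id : Fin 2 → Fin 2)
      ⟨diagGL2 1 u, diagGL2_mem_standardParabolicGL_fin_two 1 u⟩) w = w :=
    fun u hu w => apply_leviProjection_diagGL2_swap_eq_of_jacquetGL_eq σ hσs hscalar
      (by rw [hJN2, hW1]) hu (htrivJ u hu) w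
  obtain ⟨f₀, hf₀0, hf₀K⟩ := exists_mem_fixedPoints_glInt_parabolicIndGL_fin_two σ
    (apply_leviProjection_eq_of_mem_glInt σ h₁ h₂)
  -- Step E: `π ↪ I` is onto (no supercuspidal subquotient; `B` is the only proper parabolic)
  have hsurj : Function.Surjective f := by
    by_contra hns
    have hlt : f.range < ⊤ := by
      refine lt_top_iff_ne_top.2 fun htop => hns ?_
      have h1 : LinearMap.range f.toLinearMap = ⊤ := by
        have h2 := congrArg Subrepresentation.toSubmodule htop
        rwa [Representation.IntertwiningMap.range_toSubmodule] at h2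
      exact LinearMap.range_eq_top.1 h1
    have hcp : IsProperBlocks (id : Fin 2 → Fin 2) := ⟨Function.surjective_id, inferInstance⟩
    have hσZ : ∀ u : Fˣ, ∃ cu : ℂ, ∀ w, σ (leviProjection F (id : Fin 2 → Fin 2)
        ⟨_, scalar_mem_standardParabolicGL (id : Fin 2 → Fin 2) u⟩) w = cu • w := fun u => hscalar _
    obtain ⟨r, c, hcp', hcm, hlt'⟩ := exists_jacquetImage_lt hIs
      (fun N₀' W' _ _ τ' _ hτa hτc q =>
        intertwiningMap_subrepresentation_parabolicIndGL_eq_zero monotone_id hcp hσZ hτa hτc N₀' q) hlt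
    refine isProperBlocks_fin_two_elim
      (P := fun r (c : Fin 2 → Fin r) => ¬ jacquetImage c (Representation.parabolicIndGL F (id : Fin 2 → Fin 2) σ) f.range < jacquetImage c (Representation.parabolicIndGL F (id : Fin 2 → Fin 2) σ) ⊤) ?_ c hcp' hcm hlt'
    intro hlt''
    have hall : ∀ y, y ∈ jacquetImage (id : Fin 2 → Fin 2) (Representation.parabolicIndGL F (id : Fin 2 → Fin 2) σ) f.range := by
      refine hsurjJ.forall.2 fun x => ?_
      refine (Representation.Coinvariants.mk_surjective _ x).elim fun v hv => ?_
      rw [← hv]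
      exact (mem_jacquetImage_iff _ _ _ _).2
        ⟨f v, (Representation.IntertwiningMap.mem_range _ _ f _).2 ⟨v, rfl⟩, (jacquetGLMap_mk f v).symm⟩
    exact lt_irrefl _ (lt_of_lt_of_le hlt'' fun y _ => hall y)
  -- conclusion: `f₀ = f v` with `v ≠ 0` spherical
  refine (hsurj f₀).elim fun v hv => ⟨v, fun h0 => hf₀0 ?_, ?_⟩
  · rw [← hv, h0]
    exact map_zero f
  · rw [Representation.mem_fixedPoints]
    intro k hk
    apply hf
    have h1 := f.isIntertwining _ _ k v
    have h2 := ((Representation.parabolicIndGL F (id : Fin 2 → Fin 2) σ).mem_fixedPoints (glInt 2 F) f₀).1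
      hf₀K k hk
    rw [← hv] at h2
    exact h1.trans h2

end Literature.NumberTheory.Automorphic

end
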